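import Mathlib
import HarnessLib
import Summits.NavierStokesRegularity.NavierStokesRegularity.Theses.AngularGalerkinLadder

/-! # The K3 glue of route `AngularGalerkinLadder` (item stmt-NavierStokesRegularity-19848 `LimitTransferGlue`)

`LimitTransferGlue := LocalCompactness → StructurePasses → LimitTransfer` — the composition of the rev-2 split of
crux K3 (planner g20, route rev 2, commit 841fa5b24cd2): extract the ladder limit of a window sequence
(`LocalCompactness`), then apply `StructurePasses` to it. Four lines of logic; nothing about Navier–Stokes is proved
here. WHAT THIS IS NOT: not NS. -/

set_option linter.dupNamespace false

namespace Summit.NavierStokesRegularity.NavierStokesRegularity.Theorems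

open Summit.NavierStokesRegularity.NavierStokesRegularity.Theses.AngularGalerkinLadder in
/-- item stmt-NavierStokesRegularity-19848: the split glue `LocalCompactness → StructurePasses → LimitTransfer`. -/
theorem angularGalerkinLadder_limitTransferGlue :
    Summit.NavierStokesRegularity.NavierStokesRegularity.Theses.AngularGalerkinLadder.LimitTransferGlue := by
  intro h1 h2 C₀ cmin cmax δ L ε c R u p d hcmin hδ hε hW
  obtain ⟨φ, c', R', v, q, hlim⟩ := h1 C₀ cmin cmax δ L ε c R u p d ⟨hcmin, hδ, hε, hW⟩
  exact ⟨c', R', v, h2 C₀ cmin cmax δ L ε c R u p d φ c' R' v q ⟨hcmin, hδ, hε, hW⟩ hlim⟩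

end Summit.NavierStokesRegularity.NavierStokesRegularity.Theorems
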